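import Literature.Probability.RandomPlanarGeometry.SimpleCurveLaws
import HarnessLib

/-!
# Abstract transfer along the avoidance code — stub `stub_rangeIsArc_transfer`
(line `marked-point-revisit`, crux `SAWLoopFugacityFlow.SimpleSubseqLimits`, stmt-CriticalPhenomena-4982)

Sub-stub 1 of the SHAPE stub `stub_rangeIsArc` (plan `RangeIsArc-PLAN.md` of the line): the pure
measure theory of the transfer from a measure `μ` carried by a Borel set `R` of curve classes on
which the avoidance code `c ↦ (𝟙[c.range ∩ C n = ∅])ₙ` of a sequence of closed test sets is
injective, to an ARBITRARY finite measure `ν` with the same avoidance probabilities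
`ν {range ∩ ⋃ n ∈ s, C n = ∅} = μ {…}` (`s` finite): `ν`-almost every class has the avoidance
code of some member of `R`.

Proof (a one-measure variant of the tree's `CurveClass.Measure.ext_of_missCode_injOn`,
`SimpleCurveLaws`): the image measures of `ν` and `μ` under the code agree on the π-system of
positive cylinders of `ℕ → Bool`, which generates the product σ-algebra
(`CurveClass.generateFrom_posCylinder`, `MeasureTheory.ext_of_generate_finite`), hence are
equal; by the Lusin–Souslin theorem (`MeasurableSet.image_of_measurable_injOn`; `CurveClass ℂ`
is Polish) the image `missCode C '' R` is Borel, it has full `μ.map`-mass, hence full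
`ν.map`-mass, i.e. `ν`-a.e. class has its code in `missCode C '' R`.
-/

noncomputable section

open MeasureTheory Filter Topology Set Metric
open Literature.Probability.RandomPlanarGeometry
open scoped ENNReal NNReal unitInterval

namespace Summit.CriticalPhenomena.SAWScalingLimit.Theorems.SimpleSubseqLimits.MarkedPointRevisit.ArcRange

/-- **Abstract transfer along the avoidance code.** Let `C n` be closed test sets, `R` a Borel
set of curve classes on which the avoidance code `missCode C` is injective, `μ` a finite measure
carried by `R` and `ν` a finite measure with the same mass as `μ` on every avoidance event
`{c | c.range ∩ ⋃ n ∈ s, C n = ∅}` (`s` finite; `s = ∅` is the total mass). Then `ν`-a.e. class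
has the avoidance code of some member of `R`. Proof: the two image measures on `ℕ → Bool` agree
(π-system of positive cylinders), `missCode C '' R` is Borel by the Lusin–Souslin theorem
(`CurveClass` is Polish) and has full `μ.map`-mass, hence full `ν.map`-mass. [folklore] -/
theorem transfer {C : ℕ → Set ℂ} (hC : ∀ n, IsClosed (C n)) {R : Set (CurveClass ℂ)}
    (hR : MeasurableSet R) (hinj : InjOn (CurveClass.missCode C) R)
    {ν μ : Measure (CurveClass ℂ)} [IsFiniteMeasure ν] [IsFiniteMeasure μ]
    (hμ : ∀ᵐ γ ∂μ, γ ∈ R)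
    (h : ∀ s : Finset ℕ, ν (CurveClass.rangeSubset (⋃ n ∈ s, C n)ᶜ) =
      μ (CurveClass.rangeSubset (⋃ n ∈ s, C n)ᶜ)) :
    ∀ᵐ c ∂ν, ∃ γ ∈ R, CurveClass.missCode C c = CurveClass.missCode C γ := by
  have huniv : ν univ = μ univ := by
    simpa only [CurveClass.rangeSubset_compl_biUnion_empty] using h ∅
  have hF : Measurable (CurveClass.missCode C : CurveClass ℂ → ℕ → Bool) :=
    CurveClass.measurable_missCode hC
  -- the two image measures on `ℕ → Bool` agree
  have hmap : ν.map (CurveClass.missCode C) = μ.map (CurveClass.missCode C) := by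
    refine ext_of_generate_finite (Set.range CurveClass.posCylinder)
      CurveClass.generateFrom_posCylinder.symm CurveClass.isPiSystem_posCylinder ?_ ?_
    · rintro _ ⟨s, rfl⟩
      rw [Measure.map_apply hF (CurveClass.measurableSet_posCylinder s),
        Measure.map_apply hF (CurveClass.measurableSet_posCylinder s),
        CurveClass.missCode_preimage_posCylinder]
      exact h s
    · rw [Measure.map_apply hF MeasurableSet.univ, Measure.map_apply hF MeasurableSet.univ,
        preimage_univ]
      exact huniv
  -- the image of `R` is Borel (Lusin–Souslin) and has full mass
  have hB : MeasurableSet (CurveClass.missCode C '' R) := hR.image_of_measurable_injOn hF hinj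
  have hfull : ν ((CurveClass.missCode C ⁻¹' (CurveClass.missCode C '' R))ᶜ) = 0 := by
    have hpre : MeasurableSet (CurveClass.missCode C ⁻¹' (CurveClass.missCode C '' R)) := hF hB
    have hμfull : μ ((CurveClass.missCode C ⁻¹' (CurveClass.missCode C '' R))ᶜ) = 0 := by
      refine measure_mono_null ?_ (ae_iff.1 hμ)
      intro c hc hcR
      exact hc (subset_preimage_image _ _ hcR)
    have hμpre : μ (CurveClass.missCode C ⁻¹' (CurveClass.missCode C '' R)) = μ univ := by
      have := measure_add_measure_compl (μ := μ) hpre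
      rw [hμfull, add_zero] at this
      exact this
    have hν : ν (CurveClass.missCode C ⁻¹' (CurveClass.missCode C '' R)) = ν univ := by
      rw [← Measure.map_apply hF hB, hmap, Measure.map_apply hF hB, hμpre, huniv]
    rw [measure_compl hpre (measure_ne_top ν _), hν, tsub_self]
  rw [ae_iff]
  refine measure_mono_null (fun c hc ↦ ?_) hfull
  intro hc'
  obtain ⟨γ, hγR, hγ⟩ := hc'
  exact hc ⟨γ, hγR, hγ.symm⟩


/-- **Sub-stub 1 of `stub_rangeIsArc` (registered form of `transfer`).** Closed tests `C n`, a
Borel set `R` on which the avoidance code is injective, `μ` finite carried by `R`, `ν` finite with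
the same mass on every avoidance event of a finite union of tests: then `ν`-a.e. class has the
avoidance code of some member of `R`. [folklore] -/
theorem stub_rangeIsArc_transfer :
    ∀ (C : ℕ → Set ℂ) (R : Set (CurveClass ℂ)) (ν μ : Measure (CurveClass ℂ)),
      IsFiniteMeasure ν → IsFiniteMeasure μ → (∀ n, IsClosed (C n)) → MeasurableSet R →
      InjOn (CurveClass.missCode C) R → (∀ᵐ γ ∂μ, γ ∈ R) →
      (∀ s : Finset ℕ, ν (CurveClass.rangeSubset (⋃ n ∈ s, C n)ᶜ) =
        μ (CurveClass.rangeSubset (⋃ n ∈ s, C n)ᶜ)) →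
      ∀ᵐ c ∂ν, ∃ γ ∈ R, CurveClass.missCode C c = CurveClass.missCode C γ := by
  intro C R ν μ _ _ hC hR hinj hμ h
  exact transfer hC hR hinj hμ h

end Summit.CriticalPhenomena.SAWScalingLimit.Theorems.SimpleSubseqLimits.MarkedPointRevisit.ArcRange

end
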